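import Summits.BirchSwinnertonDyer.BirchSwinnertonDyer.Theorems.Rank1ResidualX1RankOne
import Literature.NumberTheory.EllipticCurves.Rank1Residual.X1RankOneOddPrime

/-!
# Rank-≤1 BSD residual class X1 at EVERY prime of the class (`p = 3` included): the typed MISSING INPUT
# and the typed TARGET coincide modulo the Schneider certificate; the whole class reduces to Mazur's main
# conjecture at type-A pairs plus per-curve certificates — from PUBLISHED theorems only

HONEST FRAMING (cell `b2b-bsdres`, home `run/shared/lean/b2b/bsd-rank1-residual/`, unit
`b2b-bsdres-x1b`, prover B = the independent patchwork, no Keller–Yin input, GEN 4). The goal is to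
DELETE the COMBINATION-SHAPED residual classes for ALL analytic-rank `≤ 1` curves over `ℚ` — "full BSD
formula for every rank `≤ 1` curve in class C" assembled STRICTLY from published theorems — so that the
rank-`≤ 1` remainder becomes exactly the CONSTRUCTION-SHAPED classes, which are TYPED (missing-input
`Prop`s), NOT attempted; this is not "finishing BSD". Helper file of the crux `PAdicOrderMainConjectureR5`
(stmt-BirchSwinnertonDyer-15418), continuation of `Rank1ResidualX1RankOne` (gen 3, `p ≥ 5`) and
`Rank1ResidualX1Converse` (gen 2, rank `0`), in prover A's vocabulary (`MazurMainConjecture W p`,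
`MazurMainConjectureOnX1TypeA`, `BSDpOnClassX1` of `Rank1ResidualX1Defs`).

Gen 4 removed the restriction `5 ≤ p` of the rank-one engine (3-adic vocabulary:
`Literature/…/PadicSigmaOddPrime.lean` — THE canonical cyclotomic `p`-adic height exists uniquely at every
odd good ordinary prime from the single named fact `mazur_tate_sigma_exists_odd` (Mazur–Tate 1991 /
Mazur–Stein–Tate 2006 Thm. 1.3 / Balakrishnan 2016 (2.3)); the analytic facts at their printed odd-prime
generality `Schneider1985_order_charGenerator_odd` (BMS 2016 Thm. 1.7, `p > 2`) and
`perrinRiou_rankOne_leadingTerms_odd` (Perrin-Riou 1987, `p` odd); engine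
`Wuthrich2014/RankOne{Engine,Converse}OddPrimeProofs`, class file `Rank1Residual/X1RankOneOddPrime`). Since
`ClassX1 W p` contains `2 < p`, every statement below holds at ALL primes of the class. Theorems only:

* `mazurMainConjecture_iff_bsdp_of_analyticRank_eq_one` / `…_iff_missingInputAt_…` — at every X1 pair
  with `ord_{s=1} L(E,s) = 1`, modulo the certificate: `MazurMainConjecture W p ↔ BSDp W p ↔
  Typed.X1.MissingInputAt W p` (gen 3 had `5 ≤ p`);
* `mazurMainConjecture_of_bsdpOnClassX1_of_analyticRank_eq_one`,
  `mazurMainConjecture_and_bsdp_of_shaAn_unit_of_analyticRank_eq_one`,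
  `forall_mazurMainConjecture_iff_forall_bsdp_of_analyticRank_eq_one` — as in gen 3, now at every `p`;
* **`bsdpOnClassX1_of_mazurMC_typeA_of_schneider` — THE CLASS X1 IN SHAPE, prover B's version:** the
  typed target `BSDpOnClassX1` follows from (i) `MazurMainConjectureOnX1TypeA` (Mazur's main conjecture
  at the anomalous Eisenstein primes of parity type A — unstated in print; EXACTLY the typed residue the
  referee ruled for X1b, R7.2/R9.2) and (ii) Schneider's non-degeneracy at the rank-one X1 pairs (a
  class-level open statement, certified per pair by a finite `p`-adic computation), everything else being
  PUBLISHED: Greenberg–Vatsal 2000 Thm. 1.3 (type B), Greenberg 1999 Thm. 4.1, Wuthrich 2014 Thm. 16,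
  Perrin-Riou–Schneider, Perrin-Riou 1987, Mazur–Tate's sigma function, modularity, GZK. Compare prover
  A's `bsdpOnClassX1_of_typedInputs'` (`Rank1ResidualX1Defs`): inputs (i) AND the Keller–Yin PREPRINT
  display `thm421_rankOne_display_OPEN`. The present route trades the preprint for the per-curve
  certificate; neither seat closes X1, and the two residues agree on (i);
* `forall_mazurMainConjecture_iff_bsdpOnClassX1_of_schneider` — granted the certificates at the rank-one
  pairs, "Mazur's main conjecture at every X1 pair of analytic rank `≤ 1`" ⟺ `BSDpOnClassX1`: the typed
  input and the typed target of the WHOLE class are one statement on the published record (gen 2 did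
  `r = 0`, gen 3 `r = 1 ∧ p ≥ 5`, gen 4 the rest).

Census pointer (prover A's table `x1_gvtype_classes_j041378.tsv`; not a verdict): X1 ∩ {r_an = 1} =
434 pairs with `N < 10⁴` (754 with `N < 2·10⁴`); 396 (683) at `p = 3`, of which 15 (27) of type B — now
inside B1's theorem `Rank1Residual.X1.bsdp_of_gvPar_of_analyticRank_eq_one` modulo a 3-adic certificate,
without the preprint — and 381 (656) of type A, where the certificate makes `BSD(E,3)` equivalent to
Mazur's main conjecture at `(E,3)` and, with `3 ∤ #Ш_an` (every census pair), PROVES both.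

References: [Wuthrich2014] Thm. 16, §6; [PerrinRiou1987] §1.4 Cor. 1.8; [BalakrishnanMullerStein2015]
Thm. 1.7; [Balakrishnan2016] §2; [MazurSteinTate2006] Thm. 1.3; [GreenbergVatsal2000] Thm. (1.3);
[GreenbergLNM1716] Thm. 4.1; [SteinWuthrich2013] §§3–4, §9; [KellerYin2024] Thm. 4.2.1 (for comparison
only; not an input); [Miller2011LMS] Def. 1.1.
-/

noncomputable section

open scoped Classical MatrixGroups ModularForm

open CongruenceSubgroup WeierstrassCurve Literature.NumberTheory.EllipticCurves
  Literature.NumberTheory.EllipticCurves.ModularForms Literature.NumberTheory.EllipticCurves.Rank1Residual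
  Literature.NumberTheory.EllipticCurves.Rank1Residual.Typed
  Summit.BirchSwinnertonDyer.BirchSwinnertonDyer.Theorems.Rank1ResidualX1Defs
  Summit.BirchSwinnertonDyer.BirchSwinnertonDyer.Theorems.Rank1ResidualX1Converse

set_option linter.dupNamespace false
set_option autoImplicit false

namespace Summit.BirchSwinnertonDyer.BirchSwinnertonDyer.Theorems.Rank1ResidualX1RankOneOddPrime

/-! ### Pair by pair, analytic rank one, every prime of the class -/

/-- **X1 ∩ {r = 1}, every `p`: the typed missing input IS the typed target, pair by pair, modulo the
Schneider certificate.** For `W/ℚ` globally minimal elliptic and `p` prime with `ClassX1 W p` (so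
`2 < p`), `ord_{s=1} L(E,s) = 1`, and Schneider's non-degeneracy of the canonical `p`-adic height
(`hSch`), granted the PUBLISHED named facts Wuthrich 2014 Thm. 16 (`hW16`), Perrin-Riou–Schneider at odd
`p` (`hS`), Perrin-Riou 1987 at odd `p` (`hPR`), the Mazur–Tate sigma function at odd `p` (`hMT`),
modularity (`hmod`) and Gross–Zagier–Kolyvagin (`hGZK`): `MazurMainConjecture W p ↔ BSDp W p`.
Gen 3's `Rank1ResidualX1RankOne.mazurMainConjecture_iff_bsdp_of_analyticRank_eq_one` is the case
`p ≥ 5`. [cite: Wuthrich2014, Thm. 16 (p. 393) and §6 (p. 400)] [cite: PerrinRiou1987, §1.4 Cor. 1.8]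
[cite: BalakrishnanMullerStein2015, Thm. 1.7] [cite: Balakrishnan2016, §2] -/
theorem mazurMainConjecture_iff_bsdp_of_analyticRank_eq_one
    (hW16 : Wuthrich2014.charIdeal_dvd_padicLFunction) (hS : Schneider1985_order_charGenerator_odd)
    (hPR : perrinRiou_rankOne_leadingTerms_odd) (hMT : mazur_tate_sigma_exists_odd)
    (hmod : nonempty_modularParametrizationData) (hGZK : rank_eq_analyticRank_of_analyticRank_le_one)
    (W : WeierstrassCurve ℚ) [W.IsElliptic] [W.IsGloballyMinimal] (p : ℕ) [Fact p.Prime]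
    (hX1 : ClassX1 W p) (hr1 : W.analyticRank = 1)
    (hSch : ∀ Dh : PAdicHeightData W p, Dh.IsCanonical → SchneiderConjecture Dh) :
    MazurMainConjecture W p ↔ BSDp W p :=
  X1.mainConjecture_iff_bsdp_of_analyticRank_eq_one hW16 hS hPR hMT hmod hGZK W p hX1 hr1 hSch

/-- **X1 ∩ {r = 1}, every `p`: prover A's typed input ⟺ prover B's typed residual**
(`Typed.X1.MissingInputAt`), modulo the certificate, same facts. [cite: Wuthrich2014, Thm. 16 and §6]
[cite: PerrinRiou1987, §1.4 Cor. 1.8] [cite: Balakrishnan2016, §2] -/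
theorem mazurMainConjecture_iff_missingInputAt_of_analyticRank_eq_one
    (hW16 : Wuthrich2014.charIdeal_dvd_padicLFunction) (hS : Schneider1985_order_charGenerator_odd)
    (hPR : perrinRiou_rankOne_leadingTerms_odd) (hMT : mazur_tate_sigma_exists_odd)
    (hmod : nonempty_modularParametrizationData) (hGZK : rank_eq_analyticRank_of_analyticRank_le_one)
    (W : WeierstrassCurve ℚ) [W.IsElliptic] [W.IsGloballyMinimal] (p : ℕ) [Fact p.Prime]
    (hX1 : ClassX1 W p) (hr1 : W.analyticRank = 1)
    (hSch : ∀ Dh : PAdicHeightData W p, Dh.IsCanonical → SchneiderConjecture Dh) :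
    MazurMainConjecture W p ↔ X1.MissingInputAt W p :=
  X1.mainConjecture_iff_missingInputAt_of_analyticRank_eq_one hW16 hS hPR hMT hmod hGZK W p hX1 hr1 hSch

/-- **The typed TARGET implies the typed INPUT on `r_an = 1`, every `p`** (modulo the certificate).
[cite: Wuthrich2014, Thm. 16 and §6] [cite: PerrinRiou1987, §1.4 Cor. 1.8] -/
theorem mazurMainConjecture_of_bsdpOnClassX1_of_analyticRank_eq_one (hT : BSDpOnClassX1)
    (hW16 : Wuthrich2014.charIdeal_dvd_padicLFunction) (hS : Schneider1985_order_charGenerator_odd)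
    (hPR : perrinRiou_rankOne_leadingTerms_odd) (hMT : mazur_tate_sigma_exists_odd)
    (hmod : nonempty_modularParametrizationData) (hGZK : rank_eq_analyticRank_of_analyticRank_le_one)
    (W : WeierstrassCurve ℚ) [W.IsElliptic] [W.IsGloballyMinimal] (p : ℕ) [Fact p.Prime]
    (hX1 : ClassX1 W p) (hr1 : W.analyticRank = 1)
    (hSch : ∀ Dh : PAdicHeightData W p, Dh.IsCanonical → SchneiderConjecture Dh) :
    MazurMainConjecture W p :=
  (mazurMainConjecture_iff_bsdp_of_analyticRank_eq_one hW16 hS hPR hMT hmod hGZK W p hX1 hr1 hSch).mpr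
    (hT W p hX1 hr1.le)

/-- **Per pair: `p ∤ #Ш(E/ℚ)_an` + certificate ⟹ `MazurMainConjecture W p` AND `BSDp W p`** at an X1
pair with `ord_{s=1} L(E,s) = 1`, every `p` (Wuthrich Thm. 16, Perrin-Riou–Schneider, Perrin-Riou,
Mazur–Tate sigma, modularity, GZK). All 434 rank-one X1 pairs of conductor `< 10⁴` (396 of them at
`p = 3`) have `p ∤ #Ш_an` (census pointer, not a verdict). [cite: Wuthrich2014, Thm. 16 and §6]
[cite: PerrinRiou1987, §1.4 Cor. 1.8] [cite: Balakrishnan2016, §2 and §4]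
[cite: Miller2011LMS, Def. 1.1 (arXiv:1010.2431 p. 3)] -/
theorem mazurMainConjecture_and_bsdp_of_shaAn_unit_of_analyticRank_eq_one
    (hW16 : Wuthrich2014.charIdeal_dvd_padicLFunction) (hS : Schneider1985_order_charGenerator_odd)
    (hPR : perrinRiou_rankOne_leadingTerms_odd) (hMT : mazur_tate_sigma_exists_odd)
    (hmod : nonempty_modularParametrizationData) (hGZK : rank_eq_analyticRank_of_analyticRank_le_one)
    (W : WeierstrassCurve ℚ) [W.IsElliptic] [W.IsGloballyMinimal] (p : ℕ) [Fact p.Prime]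
    (hX1 : ClassX1 W p) (hr1 : W.analyticRank = 1)
    (hSch : ∀ Dh : PAdicHeightData W p, Dh.IsCanonical → SchneiderConjecture Dh)
    (hunit : ∃ q : ℚ, shaAn W = (q : ℂ) ∧ padicValRat p q = 0) :
    MazurMainConjecture W p ∧ BSDp W p := by
  obtain ⟨hbsd, hMC⟩ := X1.bsdp_and_mainConjecture_of_analyticRank_eq_one_of_shaAn_unit hW16 hS hPR hMT
    hmod hGZK W p hX1 hr1 hSch hunit
  exact ⟨hMC, hbsd⟩

/-- **Class level, `r_an = 1`, every `p`, modulo the certificate: "Mazur's main conjecture at every such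
X1 pair" ⟺ "`BSD(E,p)` at every such X1 pair"** (same published facts).
[cite: Wuthrich2014, Thm. 16 and §6] [cite: PerrinRiou1987, §1.4 Cor. 1.8] -/
theorem forall_mazurMainConjecture_iff_forall_bsdp_of_analyticRank_eq_one
    (hW16 : Wuthrich2014.charIdeal_dvd_padicLFunction) (hS : Schneider1985_order_charGenerator_odd)
    (hPR : perrinRiou_rankOne_leadingTerms_odd) (hMT : mazur_tate_sigma_exists_odd)
    (hmod : nonempty_modularParametrizationData) (hGZK : rank_eq_analyticRank_of_analyticRank_le_one) :
    (∀ (W : WeierstrassCurve ℚ) [W.IsElliptic] [W.IsGloballyMinimal] (p : ℕ) [Fact p.Prime],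
        ClassX1 W p → W.analyticRank = 1 →
        (∀ Dh : PAdicHeightData W p, Dh.IsCanonical → SchneiderConjecture Dh) →
        MazurMainConjecture W p) ↔
    (∀ (W : WeierstrassCurve ℚ) [W.IsElliptic] [W.IsGloballyMinimal] (p : ℕ) [Fact p.Prime],
        ClassX1 W p → W.analyticRank = 1 →
        (∀ Dh : PAdicHeightData W p, Dh.IsCanonical → SchneiderConjecture Dh) → BSDp W p) := by
  constructor
  · intro h W _ _ p _ hX1 hr1 hSch
    exact (mazurMainConjecture_iff_bsdp_of_analyticRank_eq_one hW16 hS hPR hMT hmod hGZK W p hX1 hr1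
      hSch).mp (h W p hX1 hr1 hSch)
  · intro h W _ _ p _ hX1 hr1 hSch
    exact (mazurMainConjecture_iff_bsdp_of_analyticRank_eq_one hW16 hS hPR hMT hmod hGZK W p hX1 hr1
      hSch).mpr (h W p hX1 hr1 hSch)

/-! ### The whole class X1 in shape, prover B's version: no preprint, per-curve certificates instead -/

/-- **CLASS X1 FROM ITS TYPED RESIDUE PLUS CERTIFICATES (published inputs otherwise).** The typed target
`BSDpOnClassX1` (Miller's `BSD(E,p)` at every X1 pair with `ord_{s=1} L(E,s) ≤ 1`) follows from
(i) `MazurMainConjectureOnX1TypeA` — Mazur's cyclotomic main conjecture at the anomalous Eisenstein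
primes of parity type A (UNSTATED in print; the referee's exact residue of X1b) — and (ii) Schneider's
non-degeneracy of the canonical `p`-adic height at every X1 pair of analytic rank one (`hSchX1`; a
class-level open statement, a finite `p`-adic computation per pair), granted the PUBLISHED named facts
Greenberg–Vatsal 2000 Thm. 1.3 (`hGV`, type B), Greenberg 1999 Thm. 4.1 (`hGr`, rank `0`),
Perrin-Riou–Schneider (`hS`), Perrin-Riou 1987 (`hPR`), Mazur–Tate sigma (`hMT`), modularity (`hmod`),
GZK (`hGZK`). Rank `0`: the class clause forces type A and `bsdp_of_classX1_typeA_of_analyticRank_eq_zero`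
(prover A, gen 1) applies; rank `1`, type B: `Rank1Residual.X1.bsdp_of_gvPar_of_analyticRank_eq_one`
(B1, every `p`); rank `1`, type A: (i) gives `MazurMainConjecture W p` and
`mazurMainConjecture_iff_bsdp_of_analyticRank_eq_one` converts it (Wuthrich's Thm. 16 is not even needed in
this direction, but the iff is the cleanest route). Prover A's `bsdpOnClassX1_of_typedInputs'` reaches
the same target from (i) and the Keller–Yin PREPRINT display; here the preprint is replaced by (ii).
[cite: GreenbergVatsal2000, Thm. (1.3)] [cite: GreenbergLNM1716, Thm. 4.1 (p. 102)]
[cite: PerrinRiou1987, §1.4 Cor. 1.8] [cite: BalakrishnanMullerStein2015, Thm. 1.7]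
[cite: Balakrishnan2016, §2] [cite: Miller2011LMS, Def. 1.1 (arXiv:1010.2431 p. 3)] -/
theorem bsdpOnClassX1_of_mazurMC_typeA_of_schneider (hA : MazurMainConjectureOnX1TypeA)
    (hSchX1 : ∀ (W : WeierstrassCurve ℚ) [W.IsElliptic] [W.IsGloballyMinimal] (p : ℕ) [Fact p.Prime],
      ClassX1 W p → W.analyticRank = 1 →
        ∀ Dh : PAdicHeightData W p, Dh.IsCanonical → SchneiderConjecture Dh)
    (hGV : GreenbergVatsal2000.thm13_charIdeal_eq_of_gvPar) (hGr : greenberg_charValue_rankZero)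
    (hW16 : Wuthrich2014.charIdeal_dvd_padicLFunction) (hS : Schneider1985_order_charGenerator_odd)
    (hPR : perrinRiou_rankOne_leadingTerms_odd) (hMT : mazur_tate_sigma_exists_odd)
    (hmod : nonempty_modularParametrizationData) (hGZK : rank_eq_analyticRank_of_analyticRank_le_one) :
    BSDpOnClassX1 := by
  intro W _ _ p _ hX1 hr
  rcases Nat.le_one_iff_eq_zero_or_eq_one.mp hr with h0 | h1
  · have hnot : ¬ GVPar W p := fun hgv ↦ hX1.2.2.2.2 ⟨h0, hgv⟩
    exact Rank1ResidualX1Defs.bsdp_of_classX1_typeA_of_analyticRank_eq_zero hA hGr hmod hGZK W p hX1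
      hnot h0
  · by_cases hpar : GVPar W p
    · exact X1.bsdp_of_gvPar_of_analyticRank_eq_one hGV hS hPR hMT hmod hGZK W p hX1 h1 hpar
        (hSchX1 W p hX1 h1)
    · exact (mazurMainConjecture_iff_bsdp_of_analyticRank_eq_one hW16 hS hPR hMT hmod hGZK W p hX1 h1
        (hSchX1 W p hX1 h1)).mp (hA W p hX1 hpar)

/-- **Converse direction, whole class: the typed target gives Mazur's main conjecture at every X1 pair of
analytic rank `≤ 1`** (rank `0`: gen 2's `mazurMainConjecture_of_bsdpOnClassX1`, no certificate; rank
`1`: modulo the certificate). [cite: Wuthrich2014, Thm. 16 and §6] [cite: GreenbergLNM1716, Thm. 4.1]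
[cite: PerrinRiou1987, §1.4 Cor. 1.8] -/
theorem mazurMainConjecture_of_bsdpOnClassX1_of_analyticRank_le_one (hT : BSDpOnClassX1)
    (hGr : greenberg_charValue_rankZero) (hW16 : Wuthrich2014.charIdeal_dvd_padicLFunction)
    (hS : Schneider1985_order_charGenerator_odd) (hPR : perrinRiou_rankOne_leadingTerms_odd)
    (hMT : mazur_tate_sigma_exists_odd) (hmod : nonempty_modularParametrizationData)
    (hGZK : rank_eq_analyticRank_of_analyticRank_le_one)
    (W : WeierstrassCurve ℚ) [W.IsElliptic] [W.IsGloballyMinimal] (p : ℕ) [Fact p.Prime]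
    (hX1 : ClassX1 W p) (hr : W.analyticRank ≤ 1)
    (hSch : W.analyticRank = 1 → ∀ Dh : PAdicHeightData W p, Dh.IsCanonical → SchneiderConjecture Dh) :
    MazurMainConjecture W p := by
  rcases Nat.le_one_iff_eq_zero_or_eq_one.mp hr with h0 | h1
  · exact mazurMainConjecture_of_bsdpOnClassX1 hT hW16 hGr hmod hGZK W p hX1 h0
  · exact mazurMainConjecture_of_bsdpOnClassX1_of_analyticRank_eq_one hT hW16 hS hPR hMT hmod hGZK W p
      hX1 h1 (hSch h1)

/-- **WHOLE CLASS, modulo the rank-one certificates: "Mazur's main conjecture at every X1 pair of analytic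
rank `≤ 1`" ⟺ `BSDpOnClassX1`.** Granted Schneider's non-degeneracy at the rank-one X1 pairs (`hSchX1`)
and the PUBLISHED facts (Greenberg 4.1, Wuthrich Thm. 16, Perrin-Riou–Schneider, Perrin-Riou 1987,
Mazur–Tate sigma, modularity, GZK), the typed INPUT and the typed TARGET of class X1
are one statement — gen 2 proved the rank-`0` slice, gen 3 the slice `r = 1 ∧ p ≥ 5`, this closes the
identification on all of X1 ∩ {r ≤ 1}. (At type-B pairs the left side is Greenberg–Vatsal's theorem, so
the genuinely open content of the left side is `MazurMainConjectureOnX1TypeA` restricted to `r_an ≤ 1`.)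
[cite: Wuthrich2014, Thm. 16 and §6] [cite: GreenbergLNM1716, Thm. 4.1] [cite: GreenbergVatsal2000, Thm. (1.3)]
[cite: PerrinRiou1987, §1.4 Cor. 1.8] [cite: BalakrishnanMullerStein2015, Thm. 1.7] -/
theorem forall_mazurMainConjecture_iff_bsdpOnClassX1_of_schneider
    (hSchX1 : ∀ (W : WeierstrassCurve ℚ) [W.IsElliptic] [W.IsGloballyMinimal] (p : ℕ) [Fact p.Prime],
      ClassX1 W p → W.analyticRank = 1 →
        ∀ Dh : PAdicHeightData W p, Dh.IsCanonical → SchneiderConjecture Dh)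
    (hGr : greenberg_charValue_rankZero)
    (hW16 : Wuthrich2014.charIdeal_dvd_padicLFunction) (hS : Schneider1985_order_charGenerator_odd)
    (hPR : perrinRiou_rankOne_leadingTerms_odd) (hMT : mazur_tate_sigma_exists_odd)
    (hmod : nonempty_modularParametrizationData) (hGZK : rank_eq_analyticRank_of_analyticRank_le_one) :
    (∀ (W : WeierstrassCurve ℚ) [W.IsElliptic] [W.IsGloballyMinimal] (p : ℕ) [Fact p.Prime],
        ClassX1 W p → W.analyticRank ≤ 1 → MazurMainConjecture W p) ↔ BSDpOnClassX1 := by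
  constructor
  · intro h W _ _ p _ hX1 hr
    rcases Nat.le_one_iff_eq_zero_or_eq_one.mp hr with h0 | h1
    · exact Rank1ResidualX1Defs.bsdp_of_classX1_of_analyticRank_eq_zero hGr hmod hGZK W p hX1 h0
        (h W p hX1 hr)
    · exact (mazurMainConjecture_iff_bsdp_of_analyticRank_eq_one hW16 hS hPR hMT hmod hGZK W p hX1 h1
        (hSchX1 W p hX1 h1)).mp (h W p hX1 hr)
  · intro hT W _ _ p _ hX1 hr
    exact mazurMainConjecture_of_bsdpOnClassX1_of_analyticRank_le_one hT hGr hW16 hS hPR hMT hmod hGZK W p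
      hX1 hr (fun h1 ↦ hSchX1 W p hX1 h1)

/-! ### Appended (gen 4): the typed input at a pair gives the target with no Wuthrich input -/

/-- **X1 ∩ {r = 1}, every `p`: `MazurMainConjecture W p` ⟹ `BSDp W p` modulo the Schneider certificate,
with NO Wuthrich input** (Perrin-Riou–Schneider `hS`, Perrin-Riou 1987 `hPR`, Mazur–Tate sigma `hMT`,
modularity `hmod`, GZK `hGZK`): the direction in which the typed INPUT is consumed. The rank-one
counterpart of prover A's `bsdp_of_classX1_of_analyticRank_eq_zero` (rank `0`: Greenberg Thm. 4.1 +
main conjecture ⟹ `BSDp`). [cite: PerrinRiou1987, §1.4 Cor. 1.8] [cite: BalakrishnanMullerStein2015, Thm. 1.7]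
[cite: Balakrishnan2016, §2] [cite: Miller2011LMS, Def. 1.1 (arXiv:1010.2431 p. 3)] -/
theorem bsdp_of_classX1_of_analyticRank_eq_one_of_mazurMC (hS : Schneider1985_order_charGenerator_odd)
    (hPR : perrinRiou_rankOne_leadingTerms_odd) (hMT : mazur_tate_sigma_exists_odd)
    (hmod : nonempty_modularParametrizationData) (hGZK : rank_eq_analyticRank_of_analyticRank_le_one)
    (W : WeierstrassCurve ℚ) [W.IsElliptic] [W.IsGloballyMinimal] (p : ℕ) [Fact p.Prime]
    (hX1 : ClassX1 W p) (hr1 : W.analyticRank = 1)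
    (hSch : ∀ Dh : PAdicHeightData W p, Dh.IsCanonical → SchneiderConjecture Dh)
    (hMC : MazurMainConjecture W p) : BSDp W p :=
  have hX := isClassX1_of_classX1 hX1
  bsdp_of_missingPPartAt W p hGZK hr1.le
    (Wuthrich2014.missingPPartAt_of_mainConjecture_of_rank_one_odd hS hPR hMT hmod hGZK W p hX1.1.ne'
      hX.hasGoodReductionAtPrime hX.not_dvd_frobeniusTrace hr1 hSch hMC)

/-- **CLASS X1 FROM ITS TYPED RESIDUE PLUS CERTIFICATES, without Wuthrich's Thm. 16** (variant of
`bsdpOnClassX1_of_mazurMC_typeA_of_schneider`): `BSDpOnClassX1` ⇐ `MazurMainConjectureOnX1TypeA` +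
Schneider certificates at the rank-one X1 pairs, granted Greenberg–Vatsal 2000 Thm. 1.3 (`hGV`),
Greenberg Thm. 4.1 (`hGr`), Perrin-Riou–Schneider (`hS`), Perrin-Riou 1987 (`hPR`), Mazur–Tate sigma
(`hMT`), modularity (`hmod`), GZK (`hGZK`) — the minimal published binder set of prover B's reduction
(Wuthrich's divisibility is needed only for the converse direction `BSDp ⟹ MC` and for the class-wide
upper bound). [cite: GreenbergVatsal2000, Thm. (1.3)] [cite: GreenbergLNM1716, Thm. 4.1 (p. 102)]
[cite: PerrinRiou1987, §1.4 Cor. 1.8] [cite: BalakrishnanMullerStein2015, Thm. 1.7] [cite: Balakrishnan2016, §2] -/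
theorem bsdpOnClassX1_of_mazurMC_typeA_of_schneider' (hA : MazurMainConjectureOnX1TypeA)
    (hSchX1 : ∀ (W : WeierstrassCurve ℚ) [W.IsElliptic] [W.IsGloballyMinimal] (p : ℕ) [Fact p.Prime],
      ClassX1 W p → W.analyticRank = 1 →
        ∀ Dh : PAdicHeightData W p, Dh.IsCanonical → SchneiderConjecture Dh)
    (hGV : GreenbergVatsal2000.thm13_charIdeal_eq_of_gvPar) (hGr : greenberg_charValue_rankZero)
    (hS : Schneider1985_order_charGenerator_odd) (hPR : perrinRiou_rankOne_leadingTerms_odd)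
    (hMT : mazur_tate_sigma_exists_odd) (hmod : nonempty_modularParametrizationData)
    (hGZK : rank_eq_analyticRank_of_analyticRank_le_one) : BSDpOnClassX1 := by
  intro W _ _ p _ hX1 hr
  rcases Nat.le_one_iff_eq_zero_or_eq_one.mp hr with h0 | h1
  · have hnot : ¬ GVPar W p := fun hgv ↦ hX1.2.2.2.2 ⟨h0, hgv⟩
    exact Rank1ResidualX1Defs.bsdp_of_classX1_typeA_of_analyticRank_eq_zero hA hGr hmod hGZK W p hX1
      hnot h0
  · by_cases hpar : GVPar W p
    · exact X1.bsdp_of_gvPar_of_analyticRank_eq_one hGV hS hPR hMT hmod hGZK W p hX1 h1 hpar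
        (hSchX1 W p hX1 h1)
    · exact bsdp_of_classX1_of_analyticRank_eq_one_of_mazurMC hS hPR hMT hmod hGZK W p hX1 h1
        (hSchX1 W p hX1 h1) (hA W p hX1 hpar)

end Summit.BirchSwinnertonDyer.BirchSwinnertonDyer.Theorems.Rank1ResidualX1RankOneOddPrime

end
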